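import Mathlib
import HarnessLib
import Summits.Ventures.LatticeQCDFlow.Exactness.SphereActionVariance

/-!
# Three lattice integrals of the local field against a frozen vector: `∫‖J_n + F‖² = Σ_m‖U_{nm}‖²_HS/d + ‖F‖²`, `d·∫⟪J_n + F, x_n⟫² = ∫‖J_n + F‖²`, `∫⟪J_n + G, w⟫² = Σ_m‖U_{nm}†w‖²/d + ⟪G, w⟫²`

HONEST FRAMING: exact (Metropolis-corrected) sampling algorithms for lattice gauge theory;
figures of merit are autocorrelation/cost numbers at stated couplings and volumes; no
continuum-physics claim.

Venture `LatticeQCDFlow` (cell pub-lqcd), topic `Exactness`; FANOUT row 7 (`s0-cpn-null`).  NEW WORK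
of the cell over the tree's `Exactness/SphereActionVariance.lean` (`∫‖J_k‖²dπ̄ = Σ_m‖U_{km}‖²_HS/d`),
`Exactness/SphereLatticeMoments.lean` (first and second moments of `π̄`; the rank-one quadratic site
identity `d·∫F dπ̄ = ∫⟪a, b⟫dπ̄`) and `Exactness/SphereLOFlowAction.lean` (`localField`,
`localField_update_self`); nothing is cited as a fact.  Printed counterpart, NAMED ONLY: Engel–Schaefer,
Comput. Phys. Commun. 182 (2011) 2107, §2 eq. (7) (the local field `J_n = Σ_m U_{nm} x_m`).  These are
the moments that appear when some spins of a configuration are FROZEN and the others integrated out —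
the inputs of the two-site conditional mean of the static block term of this lineage's entropy floor
(sequel `Exactness/SphereLOCarrePairConditionalMean.lean`): after gluing, the local field of the free
spins is shifted by the frozen vector `F = U_{nk}ω_k + U_{nl}ω_l`.

## Setting

`E` finite-dimensional real inner product space, `d = dim E ≥ 2`; `Λ` finite; `Ω = S(E)^Λ`,
`π̄ = ⊗_Λ σ̄` (`σ̄ = uniformSphere volume`); couplings `U : Λ → Λ → (E →L[ℝ] E)`;
`J_n = localField U n = Σ_m U_{nm} x_m`; `b = stdOrthonormalBasis ℝ E`, `‖V‖²_HS = Σ_i ‖V b_i‖²`.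

## Content

* **`integral_norm_sq_localField_add_const`** — `∫‖J_n + F‖² dπ̄ = Σ_m‖U_{nm}‖²_HS/d + ‖F‖²` (the cross
  term is odd in each spin).
* **`finrank_mul_integral_sq_inner_localField_add_const`** — `d·∫⟪J_n + F, x_n⟫² dπ̄ = ∫‖J_n + F‖² dπ̄`
  when `U_{nn} = 0` (rank-one quadratic dependence on `x_n`).
* **`integral_sq_inner_localField_add_const`** — `∫⟪J_n + G, w⟫² dπ̄ = Σ_m‖U_{nm}†w‖²/d + ⟪G, w⟫²` for
  frozen `G`, `w` (`⟪J_n, w⟫ = Σ_m⟪U_{nm}†w, x_m⟫`, independent centred terms).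

NOT CLAIMED: anything about conditional means, the flow, or numbers (see the sequel).
-/

noncomputable section

namespace Summit.Ventures.LatticeQCDFlow.Exactness

open Function Set Metric MeasureTheory NormedSpace InnerProductSpace
open scoped RealInnerProductSpace

variable {Λ : Type*} {E : Type*} [NormedAddCommGroup E] [InnerProductSpace ℝ E]
  [FiniteDimensional ℝ E] [MeasurableSpace E] [BorelSpace E] [Fintype Λ] [DecidableEq Λ]

/-! ## The three integrals -/

section Integrals

variable [Nontrivial E] {U : Λ → Λ → (E →L[ℝ] E)}

/-- **`∫ ‖J_n + F‖² dπ̄ = Σ_m ‖U_{nm}‖²_HS/d + ‖F‖²`** for a frozen vector `F` (`d ≥ 2`; the cross term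
`2⟪J_n, F⟫` is odd in each spin). -/
theorem integral_norm_sq_localField_add_const (h2 : 2 ≤ Module.finrank ℝ E)
    (U : Λ → Λ → (E →L[ℝ] E)) (n : Λ) (F : E) :
    ∫ ω, ‖localField U n (fun i => ((ω : Λ → sphere (0 : E) 1) i : E)) + F‖ ^ 2
        ∂Measure.pi (fun _ : Λ => uniformSphere (volume : Measure E)) =
      (∑ m, ∑ i, ‖U n m (stdOrthonormalBasis ℝ E i)‖ ^ 2) / (Module.finrank ℝ E : ℝ) + ‖F‖ ^ 2 := by
  have hpt : ∀ ω : Λ → sphere (0 : E) 1, ‖localField U n (fun i => (ω i : E)) + F‖ ^ 2 =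
      ‖localField U n (fun i => (ω i : E))‖ ^ 2 +
        2 * ∑ m, ⟪ContinuousLinearMap.adjoint (U n m) F, ((ω m : sphere (0 : E) 1) : E)⟫ + ‖F‖ ^ 2 := by
    intro ω
    rw [norm_add_sq_real, localField, sum_inner]
    congr 2
    congr 1
    refine Finset.sum_congr rfl fun m _ => ?_
    rw [ContinuousLinearMap.adjoint_inner_left, real_inner_comm]
  simp_rw [hpt]
  have hJc : Continuous fun ω : Λ → sphere (0 : E) 1 => localField U n (fun i => (ω i : E)) :=
    (contDiff_localField U n (m := 0)).continuous.comp continuous_sphereConfig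
  have hsc : ∀ m, Continuous fun ω : Λ → sphere (0 : E) 1 =>
      ⟪ContinuousLinearMap.adjoint (U n m) F, ((ω m : sphere (0 : E) 1) : E)⟫ := fun m =>
    continuous_const.inner (continuous_subtype_val.comp (continuous_apply m))
  have hI1 : Integrable (fun ω : Λ → sphere (0 : E) 1 => ‖localField U n (fun i => (ω i : E))‖ ^ 2)
      (Measure.pi fun _ : Λ => uniformSphere (volume : Measure E)) :=
    integrable_pi_of_continuous _ (hJc.norm.pow 2)
  have hIs : ∀ m, Integrable (fun ω : Λ → sphere (0 : E) 1 =>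
      ⟪ContinuousLinearMap.adjoint (U n m) F, ((ω m : sphere (0 : E) 1) : E)⟫)
      (Measure.pi fun _ : Λ => uniformSphere (volume : Measure E)) := fun m =>
    integrable_pi_of_continuous _ (hsc m)
  have hI2 : Integrable (fun ω : Λ → sphere (0 : E) 1 =>
      2 * ∑ m, ⟪ContinuousLinearMap.adjoint (U n m) F, ((ω m : sphere (0 : E) 1) : E)⟫)
      (Measure.pi fun _ : Λ => uniformSphere (volume : Measure E)) :=
    (integrable_finsetSum Finset.univ fun m _ => hIs m).const_mul 2
  have hI3 : Integrable (fun _ : Λ → sphere (0 : E) 1 => ‖F‖ ^ 2)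
      (Measure.pi fun _ : Λ => uniformSphere (volume : Measure E)) := integrable_const _
  have hI12 : Integrable (fun ω : Λ → sphere (0 : E) 1 => ‖localField U n (fun i => (ω i : E))‖ ^ 2 +
      2 * ∑ m, ⟪ContinuousLinearMap.adjoint (U n m) F, ((ω m : sphere (0 : E) 1) : E)⟫)
      (Measure.pi fun _ : Λ => uniformSphere (volume : Measure E)) := hI1.add hI2
  rw [integral_add hI12 hI3, integral_add hI1 hI2, integral_const_mul,
    integral_finsetSum Finset.univ fun m _ => hIs m]
  simp_rw [integral_slin_uniform h2]
  rw [Finset.sum_const_zero, mul_zero, add_zero, integral_const, smul_eq_mul, probReal_univ, one_mul,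
    integral_norm_sq_localField h2 U n]

/-- **`d·∫ ⟪J_n + F, x_n⟫² dπ̄ = ∫ ‖J_n + F‖² dπ̄`** for a frozen vector `F` when there is no
self-coupling (`J_n` does not read `x_n`: rank-one quadratic dependence on `x_n`). -/
theorem finrank_mul_integral_sq_inner_localField_add_const (hU0 : ∀ n, U n n = 0) (n : Λ) (F : E) :
    (Module.finrank ℝ E : ℝ) *
        ∫ ω, ⟪localField U n (fun i => ((ω : Λ → sphere (0 : E) 1) i : E)) + F,
            ((ω n : sphere (0 : E) 1) : E)⟫ ^ 2
          ∂Measure.pi (fun _ : Λ => uniformSphere (volume : Measure E)) =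
      ∫ ω, ‖localField U n (fun i => ((ω : Λ → sphere (0 : E) 1) i : E)) + F‖ ^ 2
        ∂Measure.pi (fun _ : Λ => uniformSphere (volume : Measure E)) := by
  have hF : ContDiff ℝ 2 (fun x : Λ → E => ⟪localField U n x + F, x n⟫ ^ 2) :=
    (((contDiff_localField U n).add contDiff_const).inner ℝ (contDiff_apply ℝ E n)).pow 2
  have ha : Continuous fun x : Λ → E => localField U n x + F :=
    (contDiff_localField U n (m := 0)).continuous.add continuous_const
  have h := integral_site_quadratic (Λ := Λ) hF n (fun x => localField U n x + F)
    (fun x => localField U n x + F) ha ha fun x y => by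
      simp only [update_self, localField_update_self hU0, sq]
  simp_rw [real_inner_self_eq_norm_sq] at h
  exact h

/-- **`∫ ⟪J_n + G, w⟫² dπ̄ = Σ_m ‖U_{nm}† w‖²/d + ⟪G, w⟫²`** for frozen vectors `G`, `w` (`d ≥ 2`;
`⟪J_n, w⟫ = Σ_m ⟪U_{nm}† w, x_m⟫` is a sum of independent centred terms). -/
theorem integral_sq_inner_localField_add_const (h2 : 2 ≤ Module.finrank ℝ E)
    (U : Λ → Λ → (E →L[ℝ] E)) (n : Λ) (G w : E) :
    ∫ ω, ⟪localField U n (fun i => ((ω : Λ → sphere (0 : E) 1) i : E)) + G, w⟫ ^ 2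
        ∂Measure.pi (fun _ : Λ => uniformSphere (volume : Measure E)) =
      (∑ m, ‖ContinuousLinearMap.adjoint (U n m) w‖ ^ 2) / (Module.finrank ℝ E : ℝ) + ⟪G, w⟫ ^ 2 := by
  set s : Λ → (Λ → sphere (0 : E) 1) → ℝ := fun m ω =>
    ⟪ContinuousLinearMap.adjoint (U n m) w, ((ω m : sphere (0 : E) 1) : E)⟫ with hs
  have hJw : ∀ ω : Λ → sphere (0 : E) 1,
      ⟪localField U n (fun i => (ω i : E)) + G, w⟫ = ∑ m, s m ω + ⟪G, w⟫ := by
    intro ω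
    rw [inner_add_left, localField, sum_inner]
    congr 1
    refine Finset.sum_congr rfl fun m _ => ?_
    show ⟪U n m (ω m : E), w⟫ = ⟪ContinuousLinearMap.adjoint (U n m) w, ((ω m : sphere (0 : E) 1) : E)⟫
    rw [ContinuousLinearMap.adjoint_inner_left, real_inner_comm]
  have hpt : ∀ ω : Λ → sphere (0 : E) 1, ⟪localField U n (fun i => (ω i : E)) + G, w⟫ ^ 2 =
      (∑ m, ∑ m', s m ω * s m' ω) + 2 * ⟪G, w⟫ * (∑ m, s m ω) + ⟪G, w⟫ ^ 2 := by
    intro ω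
    rw [hJw ω, add_sq, sq (∑ m, s m ω), Finset.sum_mul_sum]
    ring
  simp_rw [hpt]
  have hsc : ∀ m, Continuous (s m) := fun m =>
    continuous_const.inner (continuous_subtype_val.comp (continuous_apply m))
  have hIs : ∀ m, Integrable (s m) (Measure.pi fun _ : Λ => uniformSphere (volume : Measure E)) :=
    fun m => integrable_pi_of_continuous _ (hsc m)
  have hIss : ∀ m m', Integrable (fun ω => s m ω * s m' ω)
      (Measure.pi fun _ : Λ => uniformSphere (volume : Measure E)) := fun m m' =>
    integrable_pi_of_continuous _ ((hsc m).mul (hsc m'))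
  have hIs1 : ∀ m, Integrable (fun ω => ∑ m', s m ω * s m' ω)
      (Measure.pi fun _ : Λ => uniformSphere (volume : Measure E)) := fun m =>
    integrable_finsetSum Finset.univ fun m' _ => hIss m m'
  have hI1 : Integrable (fun ω => ∑ m, ∑ m', s m ω * s m' ω)
      (Measure.pi fun _ : Λ => uniformSphere (volume : Measure E)) :=
    integrable_finsetSum Finset.univ fun m _ => hIs1 m
  have hI2 : Integrable (fun ω => 2 * ⟪G, w⟫ * ∑ m, s m ω)
      (Measure.pi fun _ : Λ => uniformSphere (volume : Measure E)) :=
    (integrable_finsetSum Finset.univ fun m _ => hIs m).const_mul _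
  have hI3 : Integrable (fun _ : Λ → sphere (0 : E) 1 => ⟪G, w⟫ ^ 2)
      (Measure.pi fun _ : Λ => uniformSphere (volume : Measure E)) := integrable_const _
  have hI12 : Integrable (fun ω => (∑ m, ∑ m', s m ω * s m' ω) + 2 * ⟪G, w⟫ * ∑ m, s m ω)
      (Measure.pi fun _ : Λ => uniformSphere (volume : Measure E)) := hI1.add hI2
  have hterm : ∀ m m', ∫ ω, s m ω * s m' ω ∂Measure.pi (fun _ : Λ => uniformSphere (volume : Measure E)) =
      if m = m' then ‖ContinuousLinearMap.adjoint (U n m) w‖ ^ 2 / (Module.finrank ℝ E : ℝ) else 0 := by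
    intro m m'
    by_cases hmm : m = m'
    · subst hmm
      rw [if_pos rfl, hs]
      simp only
      rw [integral_slin_mul_slin_same, real_inner_self_eq_norm_sq]
    · rw [if_neg hmm, hs]
      simp only
      exact integral_slin_mul_slin_ne h2 _ _ hmm
  rw [integral_add hI12 hI3, integral_add hI1 hI2, integral_const_mul,
    integral_finsetSum Finset.univ fun m _ => hIs1 m, integral_finsetSum Finset.univ fun m _ => hIs m]
  simp_rw [integral_finsetSum Finset.univ fun m' _ => hIss _ m', hterm, Finset.sum_ite_eq,
    Finset.mem_univ, if_true]
  have h0 : ∀ m, ∫ ω, s m ω ∂Measure.pi (fun _ : Λ => uniformSphere (volume : Measure E)) = 0 :=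
    fun m => by rw [hs]; exact integral_slin_uniform h2 _ m
  simp_rw [h0]
  rw [Finset.sum_const_zero, mul_zero, add_zero, integral_const, smul_eq_mul, probReal_univ, one_mul,
    Finset.sum_div]

end Integrals

end Summit.Ventures.LatticeQCDFlow.Exactness

end
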